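import Literature.NumberTheory.Rogawski1990.ArchSchwartzOrbitalIntegralConvergenceTotalUnitary  -- ★ p849184 LH2-p03 (g3): the junction `integrable_orbitalIntegrand_of_archSchwartzOn_antidiagOne_of_placewise_growth` (N = 3, e = 1 here)
import Literature.NumberTheory.Rogawski1990.ArchUnitaryThreeOrbitQuotientGrowth                 -- §3 (LH3-p03 (g2)): `exists_measure_hsOrbitBall_le_linear_of_separable`, `centralizer_comm_of_charpoly_separable_subgroup_GL_three`
import Literature.NumberTheory.Rogawski1990.ArchHyperbolicOrbitMeasureThree                      -- ★ p849356 LH2-p03 (g3): (H′-ball) `quotientMeasure_hsOrbitBall_le_linear_of_diag_hyperbolic` — ED. 2 (discharges `hHball`)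
import Literature.NumberTheory.Automorphic.UnitaryGroupArchUnimodular                            -- ★ `modularCharacterFun_archLocal_eq_one`, `antidiagOne_isHermitian`, `isUnit_antidiagOne_det`
import Literature.NumberTheory.Automorphic.ArchStableConjugacyLocalGlobal                      -- ★ `coe_archPiEquivCM_apply`
import HarnessLib

/-!
# (CONV) at EVERY regular class of `G_∞ = U(Φ₃)(L⁺ ⊗ ℝ) = U(2,1)^d`: the per-place token of ★ p849184 discharged by the elliptic∕hyperbolic dichotomy
# («(TOT-G)», the `G_∞`-side twin of ★ `ArchSchwartzOrbitalIntegralConvergenceRegular`; Beuzart-Plessis 2020 §1.5, §1.8; Harish-Chandra 1966 §9)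

Topic `NumberTheory/Rogawski1990`; namespaces `Literature.MeasureTheory.Group` (§1, generic) and `Literature.NumberTheory.Rogawski1990` (§2–§4).  THEOREMS ONLY
(no `def`, no instance, no notation, no axiom, no named fact, no `sorry`).  Cell `pub/hodgecm-mathlib`, crux H413 (`stmt-HodgeConjecture-24833`), F0∕P3c line LH2
(closer stub `stub_N8`, archimedean inner-form transfer; letters O1″ [Shelstad1979 Thm. 4.1] ∕ O3″ [Bouaziz1994 Thm. 6.2.1 (i)] about ★ `ArchSchwartzOn L 3 Φ₃ 1`); seat
LH3-p03 (g2), deal «(TOT-G)» of LH2-plan (g0) 2026-09-02T04:40:29Z.  (VOL)∕(CONV) kit, count-neutral (+0∕+0).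

THE MATHEMATICS.  Let `g ∈ 𝒞(G_∞)` (★ `ArchSchwartzOn L 3 Φ₃ 1 g`: `|g| · ‖·‖²_HS · (1 + log ‖·‖²_HS)^d ≤ C_d`), `ν` a Haar measure on `G_∞`, `m` an orbital-measure
family in WEIL FORM at the regular classes (★ `OrbitalMeasureFamily.IsQuotientOf`, conjunct (W) of ★ `ArchCompatibleFamiliesG`) and `c` a regular semisimple class
(separable characteristic polynomial over `L ⊗ ℝ`).  ★ p849184 reduces the `(m c)`-integrability of the orbital integrand `ȳ ↦ g(y γ_c y⁻¹)` to ONE token per complex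
place `w`: for `γ_w = (γ_c)_w ∈ U(Φ₃)_w ≅ U(2,1)`, SOME non-zero invariant Radon measure `μ_w` on `U(Φ₃)_w ⧸ Z(γ_w)` has `μ_w{x̄ ∣ ‖x̄ γ_w x̄⁻¹‖²_HS ≤ R} ≤ C R` (`R ≥ 1`).
We take `μ_w = dν_w ∕ dρ_w` (Weil quotient of Haar measures; `Z(γ_w)` is abelian because `γ_w` is regular, so `ρ_w` is inversion invariant) and prove the token by the
DICHOTOMY of regular semisimple elements of `U(2,1)`: either every eigenvalue is unimodular — then `γ_w` is `U(Φ₃)`-conjugate to the compact-Cartan representative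
`M(u₀,u₁,u₂)` ((α″) ★ p849192), whose centraliser is compact, and the orbit HS-ball bound `≤ C R` is (E′) ★ p849151 fed by Harish-Chandra's quadratic ball growth
(T3-out-G) ★ p849112 — or some eigenvalue is not — then `γ_w` is `U(Φ₃)`-conjugate to `diag(α, u, ᾱ⁻¹)` ((α‴) ★ `ArchUnitaryThreeRegularHyperbolicClass`) and the
bound is the hyperbolic-orbit estimate (H′-ball) (LH2-p03 (g3), typing at the time of writing; it enters here as the HYPOTHESIS `hHball` in its posted shape and is
discharged by `exact` in ED. 2).  The passage «bound at the literal representative for the Weil quotient of one Haar frame ⟹ bound at any conjugate, on any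
bicontinuously isomorphic carrier, for any invariant Radon measure» is §1, a GENERIC transport (uniqueness of invariant measures ★ `exists_eq_smul_map_cosetCongr_centralizer`;
the pulled-back ball is a translate of the model ball, ★ `descConj_cosetCongr_apply` ∕ `descConj_comp_conj_eq_descConj_smul`), of which ★ p848971 (LH2-p04) is the
`2 × 2` split instance. [BeuzartPlessis2020Asterisque, §1.8 p. 39: the orbit estimates depend on the class only; §1.2 (1.2.2), (1.2.4) p. 21; §1.5 (1.5.2)–(1.5.3) p. 31.]

The census's §1 (generic transport) is ★ `InvariantQuotientOrbitSublevelTransport`; §3 (the per-class token on the model carrier `U(Φ₃)(ℂ)`, elliptic∕hyperbolic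
dichotomy) is ★ `ArchUnitaryThreeOrbitQuotientGrowth`; this file is §2 + §4:
* §2 `charpoly_archPiEquivCM_separable_of_isRegularElt` (any `N`, `J`) — regularity over `L ⊗ ℝ` gives a separable characteristic polynomial at every complex place
  (the `G`-side twin of ★ `charpoly_archPiEquivCM_separable_of_isArchGRegular`).
* §4 **`integrable_orbitalIntegrand_of_archSchwartzOn_antidiagOne_three_of_isRegularElt`** — (CONV) on `G_∞` at EVERY regular class for every Weil-form family and every
  `g ∈ ArchSchwartzOn L 3 Φ₃ 1`, modulo the single hypothesis `hHball` ((H′-ball), LH2-p03 (g3), in its posted token shape).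
ED. 2 (append-only; 2026-09-02, after ★ p849356 (H′-ball) and ★ ED. 2 of `ArchUnitaryThreeOrbitQuotientGrowth` landed): §4′
**`integrable_orbitalIntegrand_of_archSchwartzOn_antidiagOne_three_of_isRegularElt'`** — the HEAD with `hHball` DISCHARGED: (CONV) on `G_∞ = U(2,1)^d` at EVERY regular
class, for every Weil-form family and every `g ∈ ArchSchwartzOn L 3 Φ₃ 1`, with NO hypothesis beyond regularity — the exact `G_∞`-side twin of ★ p849205.
HONEST LABEL: HC_CM is proved only modulo the 7 printed citations (2 remaining: hLiu418 = `stmt-HodgeConjecture-24832`, h413 = `stmt-HodgeConjecture-24833`) until rung 0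
closes; this file is (VOL)∕(CONV) plumbing, count-neutral (+0∕+0): it certifies that the Schwartz orbital integrals of the letters O1″∕O3″ of `stub_N8` are honest Bochner
integrals at every regular class (modulo `hHball`); it pays no organ; books unchanged.

## References
* [BeuzartPlessis2020Asterisque] R. Beuzart-Plessis, *A local trace formula for the Gan–Gross–Prasad conjecture for unitary groups: the archimedean case*,
  Astérisque 418 (2020), §1.2 (1.2.2), (1.2.4) p. 21; §1.5 (1.5.2)–(1.5.3) p. 31; §1.8 p. 39.
* [HarishChandra1966] Harish-Chandra, *Discrete series for semisimple Lie groups II*, Acta Math. 116 (1966), §9 (convergence of Schwartz orbital integrals).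
* [Folland1995] G. B. Folland, *A Course in Abstract Harmonic Analysis* (1995), §2.6 Thm. 2.49 (uniqueness of invariant measures on `G ⧸ H`), (2.52).
* [Rogawski1990] J. D. Rogawski, *Automorphic Representations of Unitary Groups in Three Variables*, Ann. of Math. Stud. 123 (1990), §3.1 p. 19, §3.6 p. 31,
  §4.3 (4.3.1) p. 43, §4.9 Prop. 4.9.1 (a) p. 55, §14.2 (14.2.1) p. 232.
* [Knapp1986] A. W. Knapp, *Representation Theory of Semisimple Groups* (1986), Ch. V §3 (Cartan subgroups of `SU(2,1)`).
-/

set_option autoImplicit false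

noncomputable section

open MeasureTheory MeasureTheory.Measure Set NumberField NumberField.InfinitePlace NumberField.mixedEmbedding
open Literature.MeasureTheory.Group Literature.NumberTheory.Automorphic Literature.NumberTheory.Automorphic.UnitaryGroup
open scoped ENNReal NNReal MatrixGroups Matrix

namespace Literature.NumberTheory.Rogawski1990

/-! ## §2 Regularity over `L ⊗ ℝ` gives a separable characteristic polynomial at every complex place (any `N`, any form `J`) -/

section Places

variable (L : Type) [Field L] [NumberField L] [IsCMField L] (N : ℕ) (J : Matrix (Fin N) (Fin N) L)

/-- **Regular semisimple over `L ⊗ ℝ` ⇒ regular semisimple at every complex place**: if `y ∈ U(J)(L⁺ ⊗ ℝ)` has separable characteristic polynomial in `GL_N(L ⊗ ℝ)`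
(★ `IsRegularElt`), then its `w`-component (★ `archPiEquivCM`, entries through ★ `evalC L w` — ★ `coe_archPiEquivCM_apply`) has separable characteristic polynomial in
`GL_N(ℂ)` (`Matrix.charpoly_map`, `Polynomial.Separable.map`).  The `G`-side twin of ★ `charpoly_archPiEquivCM_separable_of_isArchGRegular`. [cite: Rogawski1990, §3.1 p. 19; §14.2 p. 232] -/
theorem charpoly_archPiEquivCM_separable_of_isRegularElt
    (y : ↥(UnitaryGroup.arch (↥(maximalRealSubfield L)) L (IsCMField.complexConj L) N J))
    (hreg : IsRegularElt (y.val : GL (Fin N) (mixedSpace L))) (w : {w : InfinitePlace L // w.IsComplex}) :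
    ((((archPiEquivCM N L J y w : ↥(archLocal L N J w)) : GL (Fin N) ℂ)) : Matrix (Fin N) (Fin N) ℂ).charpoly.Separable := by
  have h : (((y.val : GL (Fin N) (mixedSpace L))) : Matrix (Fin N) (Fin N) (mixedSpace L)).charpoly.Separable := hreg
  have hval : ((((archPiEquivCM N L J y w : ↥(archLocal L N J w)) : GL (Fin N) ℂ)) : Matrix (Fin N) (Fin N) ℂ) =
      (((y.val : GL (Fin N) (mixedSpace L))) : Matrix (Fin N) (Fin N) (mixedSpace L)).map (evalC L w) := by
    rw [coe_archPiEquivCM_apply]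
    rfl
  rw [hval, Matrix.charpoly_map]
  exact h.map

end Places

/-! ## §4 The HEAD: (CONV) on `G_∞ = U(Φ₃)(L⁺ ⊗ ℝ)` at EVERY regular class, modulo (H′-ball) -/

section Final

variable (L : Type) [Field L] [NumberField L] [IsCMField L]

omit [NumberField L] [IsCMField L] in
/-- The place image of `Φ₃ ∈ M₃(L)` is `Φ₃ ∈ M₃(ℂ)` (entries `0, 1`); private copy of ★ `antidiagOne_three_map_embedding` (`ArchInnerTransferSideCompact`) to keep the
imports light. [cite: Rogawski1990, §1.9 p. 8] -/
private theorem antidiagOne_three_map_embedding'' (w : {w : InfinitePlace L // w.IsComplex}) :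
    (Matrix.of fun i j : Fin 3 => if i.val + j.val + 1 = 3 then (1 : L) else 0).map w.1.embedding =
      Matrix.of fun i j : Fin 3 => if i.val + j.val + 1 = 3 then (1 : ℂ) else 0 := by
  ext i j
  simp only [Matrix.map_apply, Matrix.of_apply]
  split_ifs <;> simp

variable
    [MeasurableSpace ↥(UnitaryGroup.arch (↥(maximalRealSubfield L)) L (IsCMField.complexConj L) 3
      (Matrix.of fun i j : Fin 3 => if i.val + j.val + 1 = 3 then (1 : L) else 0))]
    [BorelSpace ↥(UnitaryGroup.arch (↥(maximalRealSubfield L)) L (IsCMField.complexConj L) 3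
      (Matrix.of fun i j : Fin 3 => if i.val + j.val + 1 = 3 then (1 : L) else 0))]

/-- **(CONV) ON `G_∞ = U(Φ₃)(L⁺ ⊗ ℝ) = U(2,1)^d` AT EVERY REGULAR CLASS, modulo (H′-ball).**  For every `g ∈ 𝒞(G_∞)` = ★ `ArchSchwartzOn L 3 Φ₃ 1 g`, every Haar `ν`
(right-invariant), every orbital-measure family `m` in WEIL FORM at the regular classes (★ `IsQuotientOf`, conjunct (W) of the LH2 frame ★ `ArchCompatibleFamiliesG`) and
every REGULAR class `c` (★ `IsRegularElt` over `L ⊗ ℝ`), the orbital integrand `x̄ ↦ g(x̄ γ_c x̄⁻¹)` is `(m c)`-integrable — GIVEN the hyperbolic-orbit estimate (H′-ball)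
at the diagonal representatives of `U(Φ₃)(ℂ)` (the hypothesis `hHball`, LH2-p03 (g3)'s head in its posted token shape; discharged by `exact` in ED. 2).  PROOF: ★ p849184
`integrable_orbitalIntegrand_of_archSchwartzOn_antidiagOne_of_placewise_growth` with, at every complex place `w`, `μ_w = dν_w ∕ dρ_w` the Weil quotient of a Haar frame
(`ν_w` right-invariant: ★ `modularCharacterFun_archLocal_eq_one`; `ρ_w` inversion-invariant: `Z(γ_w)` is abelian — §2 + ★ `commute_of_charpoly_separable` — ★
`isInvInvariant_of_comm`; `μ_w ≠ 0`: ★ `quotientMeasure_ne_zero`) and `hplace w` := §3 `exists_measure_hsOrbitBall_le_linear_of_separable` through the carrier identity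
`U(Φ₃)(ℂ)_w = U(Φ₃^ℂ)` (`Φ₃.map σ_w = Φ₃`, `MulEquiv.subgroupCongr`).  The `G_∞`-side twin of ★ `integrable_orbitalIntegrand_of_archSchwartzGL_of_isArchGRegular` (LH3-p04, p849205).
HONEST LABEL: (VOL)∕(CONV) kit, count-neutral; it closes no organ of `stub_N8` (O1″ Shelstad inner-form transfer, O3″ Bouaziz remain LETTERS).
[cite: BeuzartPlessis2020Asterisque, §1.5 (1.5.2)–(1.5.3) p. 31; §1.8 p. 39] [cite: HarishChandra1966, §9] [cite: Rogawski1990, §4.3 (4.3.1) p. 43; §14.2 (14.2.1) p. 232] -/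
theorem integrable_orbitalIntegrand_of_archSchwartzOn_antidiagOne_three_of_isRegularElt
    {g : ↥(UnitaryGroup.arch (↥(maximalRealSubfield L)) L (IsCMField.complexConj L) 3
      (Matrix.of fun i j : Fin 3 => if i.val + j.val + 1 = 3 then (1 : L) else 0)) → ℂ}
    (hg : ArchSchwartzOn L 3 (Matrix.of fun i j : Fin 3 => if i.val + j.val + 1 = 3 then (1 : L) else 0) 1 g)
    (ν : Measure ↥(UnitaryGroup.arch (↥(maximalRealSubfield L)) L (IsCMField.complexConj L) 3
      (Matrix.of fun i j : Fin 3 => if i.val + j.val + 1 = 3 then (1 : L) else 0))) [ν.IsHaarMeasure] [ν.IsMulRightInvariant]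
    [∀ a : ↥(UnitaryGroup.arch (↥(maximalRealSubfield L)) L (IsCMField.complexConj L) 3
      (Matrix.of fun i j : Fin 3 => if i.val + j.val + 1 = 3 then (1 : L) else 0)),
      MeasurableSpace (↥(UnitaryGroup.arch (↥(maximalRealSubfield L)) L (IsCMField.complexConj L) 3
      (Matrix.of fun i j : Fin 3 => if i.val + j.val + 1 = 3 then (1 : L) else 0)) ⧸ Subgroup.centralizer ({a} : Set _))]
    [∀ a : ↥(UnitaryGroup.arch (↥(maximalRealSubfield L)) L (IsCMField.complexConj L) 3
      (Matrix.of fun i j : Fin 3 => if i.val + j.val + 1 = 3 then (1 : L) else 0)),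
      BorelSpace (↥(UnitaryGroup.arch (↥(maximalRealSubfield L)) L (IsCMField.complexConj L) 3
      (Matrix.of fun i j : Fin 3 => if i.val + j.val + 1 = 3 then (1 : L) else 0)) ⧸ Subgroup.centralizer ({a} : Set _))]
    (t : ∀ γ : ↥(UnitaryGroup.arch (↥(maximalRealSubfield L)) L (IsCMField.complexConj L) 3
      (Matrix.of fun i j : Fin 3 => if i.val + j.val + 1 = 3 then (1 : L) else 0)), Measure ↥(Subgroup.centralizer ({γ} : Set _)))
    (m : OrbitalMeasureFamily ↥(UnitaryGroup.arch (↥(maximalRealSubfield L)) L (IsCMField.complexConj L) 3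
      (Matrix.of fun i j : Fin 3 => if i.val + j.val + 1 = 3 then (1 : L) else 0)))
    (hW : m.IsQuotientOf (fun γ => IsRegularElt (γ.val : GL (Fin 3) (mixedSpace L))) ν t)
    (c : ConjClasses ↥(UnitaryGroup.arch (↥(maximalRealSubfield L)) L (IsCMField.complexConj L) 3
      (Matrix.of fun i j : Fin 3 => if i.val + j.val + 1 = 3 then (1 : L) else 0)))
    (hc : IsRegularElt ((Quotient.out c).val : GL (Fin 3) (mixedSpace L)))
    (hHball : ∀ [LocallyCompactSpace ↥(unitaryGroupOfForm (starRingEnd ℂ) (Matrix.of fun i j : Fin 3 => if i.val + j.val + 1 = 3 then (1 : ℂ) else 0))]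
      [SecondCountableTopology ↥(unitaryGroupOfForm (starRingEnd ℂ) (Matrix.of fun i j : Fin 3 => if i.val + j.val + 1 = 3 then (1 : ℂ) else 0))]
      [MeasurableSpace ↥(unitaryGroupOfForm (starRingEnd ℂ) (Matrix.of fun i j : Fin 3 => if i.val + j.val + 1 = 3 then (1 : ℂ) else 0))]
      [BorelSpace ↥(unitaryGroupOfForm (starRingEnd ℂ) (Matrix.of fun i j : Fin 3 => if i.val + j.val + 1 = 3 then (1 : ℂ) else 0))]
      (γ : ↥(unitaryGroupOfForm (starRingEnd ℂ) (Matrix.of fun i j : Fin 3 => if i.val + j.val + 1 = 3 then (1 : ℂ) else 0))) (α u : ℂ),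
      ((γ : GL (Fin 3) ℂ) : Matrix (Fin 3) (Fin 3) ℂ) = !![α, 0, 0; 0, u, 0; 0, 0, (star α)⁻¹] → ‖u‖ = 1 → ‖α‖ ≠ 1 →
      ∀ (ν : Measure ↥(unitaryGroupOfForm (starRingEnd ℂ) (Matrix.of fun i j : Fin 3 => if i.val + j.val + 1 = 3 then (1 : ℂ) else 0)))
        [ν.IsHaarMeasure] [ν.IsMulRightInvariant] [ν.IsInvInvariant]
        (ρ : Measure ↥(Subgroup.centralizer ({γ} : Set ↥(unitaryGroupOfForm (starRingEnd ℂ) (Matrix.of fun i j : Fin 3 => if i.val + j.val + 1 = 3 then (1 : ℂ) else 0)))))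
        [ρ.IsHaarMeasure] [ρ.IsInvInvariant]
        [MeasurableSpace (↥(unitaryGroupOfForm (starRingEnd ℂ) (Matrix.of fun i j : Fin 3 => if i.val + j.val + 1 = 3 then (1 : ℂ) else 0)) ⧸
          Subgroup.centralizer ({γ} : Set ↥(unitaryGroupOfForm (starRingEnd ℂ) (Matrix.of fun i j : Fin 3 => if i.val + j.val + 1 = 3 then (1 : ℂ) else 0))))]
        [BorelSpace (↥(unitaryGroupOfForm (starRingEnd ℂ) (Matrix.of fun i j : Fin 3 => if i.val + j.val + 1 = 3 then (1 : ℂ) else 0)) ⧸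
          Subgroup.centralizer ({γ} : Set ↥(unitaryGroupOfForm (starRingEnd ℂ) (Matrix.of fun i j : Fin 3 => if i.val + j.val + 1 = 3 then (1 : ℂ) else 0))))],
      ∃ C : ℝ, ∀ R : ℝ, 1 ≤ R →
        quotientMeasure (Subgroup.centralizer ({γ} : Set ↥(unitaryGroupOfForm (starRingEnd ℂ) (Matrix.of fun i j : Fin 3 => if i.val + j.val + 1 = 3 then (1 : ℂ) else 0)))) ρ (Literature.NumberTheory.Automorphic.isClosed_coe_centralizer_singleton γ) ν
          {x | descConj γ (Subgroup.centralizer ({γ} : Set ↥(unitaryGroupOfForm (starRingEnd ℂ) (Matrix.of fun i j : Fin 3 => if i.val + j.val + 1 = 3 then (1 : ℂ) else 0)))) (fun _ h => Subgroup.mem_centralizer_singleton_iff.1 h)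
            (fun y : ↥(unitaryGroupOfForm (starRingEnd ℂ) (Matrix.of fun i j : Fin 3 => if i.val + j.val + 1 = 3 then (1 : ℂ) else 0)) =>
              ∑ i : Fin 3, ∑ j : Fin 3, ‖((y : GL (Fin 3) ℂ) : Matrix (Fin 3) (Fin 3) ℂ) i j‖ ^ 2) x ≤ R} ≤ ENNReal.ofReal (C * R)) :
    Integrable (descConj (Quotient.out c) (Subgroup.centralizer ({Quotient.out c} : Set _))
      (fun _ h => Subgroup.mem_centralizer_singleton_iff.1 h) g) (m c) := by
  classical
  /- (0) per-place regularity, hermitian-ness of `Φ₃`, instances on the carriers `U(Φ₃)(ℂ)_w` -/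
  have hsep : ∀ w : {w : InfinitePlace L // w.IsComplex},
      ((((archPiEquivCM 3 L (Matrix.of fun i j : Fin 3 => if i.val + j.val + 1 = 3 then (1 : L) else 0) (Quotient.out c) w : ↥(archLocal L 3 (Matrix.of fun i j : Fin 3 => if i.val + j.val + 1 = 3 then (1 : L) else 0) w)) : GL (Fin 3) ℂ)) : Matrix (Fin 3) (Fin 3) ℂ).charpoly.Separable :=
    charpoly_archPiEquivCM_separable_of_isRegularElt L 3 _ (Quotient.out c) hc
  have hherm := UnitaryGroup.antidiagOne_isHermitian L 3
  have hdet : ((Matrix.of fun i j : Fin 3 => if i.val + j.val + 1 = 3 then (1 : L) else 0)).det ≠ 0 := (UnitaryGroup.isUnit_antidiagOne_det L 3).ne_zero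
  haveI hLC : ∀ w : {w : InfinitePlace L // w.IsComplex}, LocallyCompactSpace ↥(archLocal L 3 (Matrix.of fun i j : Fin 3 => if i.val + j.val + 1 = 3 then (1 : L) else 0) w) := fun w =>
    locallyCompactSpace_unitaryGroupOfForm_complex _
  haveI hSC : ∀ w : {w : InfinitePlace L // w.IsComplex}, SecondCountableTopology ↥(archLocal L 3 (Matrix.of fun i j : Fin 3 => if i.val + j.val + 1 = 3 then (1 : L) else 0) w) := fun w =>
    secondCountableTopology_unitaryGroupOfForm_complex _
  letI mG : ∀ w : {w : InfinitePlace L // w.IsComplex}, MeasurableSpace ↥(archLocal L 3 (Matrix.of fun i j : Fin 3 => if i.val + j.val + 1 = 3 then (1 : L) else 0) w) := fun w => borel _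
  haveI bG : ∀ w : {w : InfinitePlace L // w.IsComplex}, BorelSpace ↥(archLocal L 3 (Matrix.of fun i j : Fin 3 => if i.val + j.val + 1 = 3 then (1 : L) else 0) w) := fun w => ⟨rfl⟩
  letI mQ : ∀ w : {w : InfinitePlace L // w.IsComplex}, MeasurableSpace (↥(archLocal L 3 (Matrix.of fun i j : Fin 3 => if i.val + j.val + 1 = 3 then (1 : L) else 0) w) ⧸ Subgroup.centralizer ({archPiEquivCM 3 L (Matrix.of fun i j : Fin 3 => if i.val + j.val + 1 = 3 then (1 : L) else 0) (Quotient.out c) w} : Set ↥(archLocal L 3 (Matrix.of fun i j : Fin 3 => if i.val + j.val + 1 = 3 then (1 : L) else 0) w))) := fun w => borel _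
  haveI bQ : ∀ w : {w : InfinitePlace L // w.IsComplex}, BorelSpace (↥(archLocal L 3 (Matrix.of fun i j : Fin 3 => if i.val + j.val + 1 = 3 then (1 : L) else 0) w) ⧸ Subgroup.centralizer ({archPiEquivCM 3 L (Matrix.of fun i j : Fin 3 => if i.val + j.val + 1 = 3 then (1 : L) else 0) (Quotient.out c) w} : Set ↥(archLocal L 3 (Matrix.of fun i j : Fin 3 => if i.val + j.val + 1 = 3 then (1 : L) else 0) w))) := fun w => ⟨rfl⟩
  have hZc : ∀ w : {w : InfinitePlace L // w.IsComplex}, IsClosed ((Subgroup.centralizer ({archPiEquivCM 3 L (Matrix.of fun i j : Fin 3 => if i.val + j.val + 1 = 3 then (1 : L) else 0) (Quotient.out c) w} : Set ↥(archLocal L 3 (Matrix.of fun i j : Fin 3 => if i.val + j.val + 1 = 3 then (1 : L) else 0) w))) : Set ↥(archLocal L 3 (Matrix.of fun i j : Fin 3 => if i.val + j.val + 1 = 3 then (1 : L) else 0) w)) := fun w =>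
    Literature.NumberTheory.Automorphic.isClosed_coe_centralizer_singleton _
  haveI hLCZ : ∀ w : {w : InfinitePlace L // w.IsComplex}, LocallyCompactSpace ↥(Subgroup.centralizer ({archPiEquivCM 3 L (Matrix.of fun i j : Fin 3 => if i.val + j.val + 1 = 3 then (1 : L) else 0) (Quotient.out c) w} : Set ↥(archLocal L 3 (Matrix.of fun i j : Fin 3 => if i.val + j.val + 1 = 3 then (1 : L) else 0) w))) := fun w =>
    (hZc w).isClosedEmbedding_subtypeVal.locallyCompactSpace
  /- (1) the Haar frames and the Weil-form quotient measures `μ_w = dν_w ∕ dρ_w` -/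
  let νw : ∀ w : {w : InfinitePlace L // w.IsComplex}, Measure ↥(archLocal L 3 (Matrix.of fun i j : Fin 3 => if i.val + j.val + 1 = 3 then (1 : L) else 0) w) := fun w => Measure.haarMeasure (Classical.arbitrary _)
  haveI hνR : ∀ w : {w : InfinitePlace L // w.IsComplex}, (νw w).IsMulRightInvariant := fun w =>
    isMulRightInvariant_of_modularCharacterFun_eq_one (UnitaryGroup.modularCharacterFun_archLocal_eq_one L _ hherm hdet w) _
  let ρw : ∀ w : {w : InfinitePlace L // w.IsComplex}, Measure ↥(Subgroup.centralizer ({archPiEquivCM 3 L (Matrix.of fun i j : Fin 3 => if i.val + j.val + 1 = 3 then (1 : L) else 0) (Quotient.out c) w} : Set ↥(archLocal L 3 (Matrix.of fun i j : Fin 3 => if i.val + j.val + 1 = 3 then (1 : L) else 0) w))) := fun w =>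
    Measure.haarMeasure (Classical.arbitrary _)
  haveI hρI : ∀ w : {w : InfinitePlace L // w.IsComplex}, (ρw w).IsInvInvariant := fun w =>
    isInvInvariant_of_comm _ (hZc w) (centralizer_comm_of_charpoly_separable_subgroup_GL_three _ (hsep w)) (ρw w)
  let μw : ∀ w : {w : InfinitePlace L // w.IsComplex}, Measure (↥(archLocal L 3 (Matrix.of fun i j : Fin 3 => if i.val + j.val + 1 = 3 then (1 : L) else 0) w) ⧸ Subgroup.centralizer ({archPiEquivCM 3 L (Matrix.of fun i j : Fin 3 => if i.val + j.val + 1 = 3 then (1 : L) else 0) (Quotient.out c) w} : Set ↥(archLocal L 3 (Matrix.of fun i j : Fin 3 => if i.val + j.val + 1 = 3 then (1 : L) else 0) w))) := fun w =>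
    quotientMeasure (Subgroup.centralizer ({archPiEquivCM 3 L (Matrix.of fun i j : Fin 3 => if i.val + j.val + 1 = 3 then (1 : L) else 0) (Quotient.out c) w} : Set ↥(archLocal L 3 (Matrix.of fun i j : Fin 3 => if i.val + j.val + 1 = 3 then (1 : L) else 0) w))) (ρw w) (hZc w) (νw w)
  haveI hμS : ∀ w : {w : InfinitePlace L // w.IsComplex}, SMulInvariantMeasure ↥(archLocal L 3 (Matrix.of fun i j : Fin 3 => if i.val + j.val + 1 = 3 then (1 : L) else 0) w) (↥(archLocal L 3 (Matrix.of fun i j : Fin 3 => if i.val + j.val + 1 = 3 then (1 : L) else 0) w) ⧸ Subgroup.centralizer ({archPiEquivCM 3 L (Matrix.of fun i j : Fin 3 => if i.val + j.val + 1 = 3 then (1 : L) else 0) (Quotient.out c) w} : Set ↥(archLocal L 3 (Matrix.of fun i j : Fin 3 => if i.val + j.val + 1 = 3 then (1 : L) else 0) w))) (μw w) := fun w =>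
    smulInvariantMeasure_quotientMeasure _ _ _ _
  have hμ0 : ∀ w, μw w ≠ 0 := fun w => quotientMeasure_ne_zero _ _ _ _
  refine integrable_orbitalIntegrand_of_archSchwartzOn_antidiagOne_of_placewise_growth L 3 one_pos hg ν t m hW c hc μw hμ0 fun w => ?_
  /- (2) `hplace w` through the carrier identity `U(Φ₃)(ℂ)_w = U(Φ₃^ℂ)` and §3 -/
  have hEq : archLocal L 3 (Matrix.of fun i j : Fin 3 => if i.val + j.val + 1 = 3 then (1 : L) else 0) w =
      unitaryGroupOfForm (starRingEnd ℂ) (Matrix.of fun i j : Fin 3 => if i.val + j.val + 1 = 3 then (1 : ℂ) else 0) := by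
    show unitaryGroupOfForm (starRingEnd ℂ) (((Matrix.of fun i j : Fin 3 => if i.val + j.val + 1 = 3 then (1 : L) else 0)).map w.1.embedding) = _
    rw [antidiagOne_three_map_embedding'']
  haveI : LocallyCompactSpace ↥(unitaryGroupOfForm (starRingEnd ℂ) (Matrix.of fun i j : Fin 3 => if i.val + j.val + 1 = 3 then (1 : ℂ) else 0)) := locallyCompactSpace_unitaryGroupOfForm_complex _
  haveI : SecondCountableTopology ↥(unitaryGroupOfForm (starRingEnd ℂ) (Matrix.of fun i j : Fin 3 => if i.val + j.val + 1 = 3 then (1 : ℂ) else 0)) := secondCountableTopology_unitaryGroupOfForm_complex _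
  let e : ↥(archLocal L 3 (Matrix.of fun i j : Fin 3 => if i.val + j.val + 1 = 3 then (1 : L) else 0) w) ≃* ↥(unitaryGroupOfForm (starRingEnd ℂ) (Matrix.of fun i j : Fin 3 => if i.val + j.val + 1 = 3 then (1 : ℂ) else 0)) := MulEquiv.subgroupCongr hEq
  have he : Continuous e := by
    rw [Topology.IsInducing.subtypeVal.continuous_iff]
    exact continuous_subtype_val
  have hes : Continuous e.symm := by
    rw [Topology.IsInducing.subtypeVal.continuous_iff]
    exact continuous_subtype_val
  exact exists_measure_hsOrbitBall_le_linear_of_separable e he hes (archPiEquivCM 3 L (Matrix.of fun i j : Fin 3 => if i.val + j.val + 1 = 3 then (1 : L) else 0) (Quotient.out c) w) (hsep w) hHball (μw w)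


/-! ## §4′ (ED. 2) The HEAD with `hHball` discharged by ★ p849356 (H′-ball): (CONV) on `G_∞` UNCONDITIONAL at every regular class -/

/-- **(CONV) ON `G_∞ = U(Φ₃)(L⁺ ⊗ ℝ) = U(2,1)^d` AT EVERY REGULAR CLASS — UNCONDITIONAL (ED. 2).**  For every `g ∈ 𝒞(G_∞)` = ★ `ArchSchwartzOn L 3 Φ₃ 1 g`, every Haar `ν`
(right-invariant), every orbital-measure family `m` in WEIL FORM at the regular classes (★ `IsQuotientOf`, conjunct (W) of ★ `ArchCompatibleFamiliesG`) and every REGULAR class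
`c` (★ `IsRegularElt` over `L ⊗ ℝ`), the orbital integrand `x̄ ↦ g(x̄ γ_c x̄⁻¹)` is `(m c)`-integrable — so ★ `classOrbitalIntegral m g c` and every summand of the stable orbital
integrals of the letters O1″∕O3″ of `stub_N8` at the regular classes are honest Bochner integrals.  `hHball` of ED. 1 := ★ `quotientMeasure_hsOrbitBall_le_linear_of_diag_hyperbolic`
(LH2-p03 (g3), p849356).  The by-name chain: ★ p849184 (junction) ∘ ★ p849327∕ED. 2 (per-class token: (α″)(Z′) p849192, (E′) p849151, (T3-out-G) p849112, (α‴) p849262, (H′-ball)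
p849356, transport p849310).  HONEST LABEL: (VOL)∕(CONV) kit, count-neutral; it closes no organ of `stub_N8`∕`stub_N9` (O1″∕O1 Shelstad transfers, O3″∕O3′ Bouaziz remain LETTERS).
[cite: BeuzartPlessis2020Asterisque, §1.5 (1.5.2)–(1.5.3) p. 31; §1.8 p. 39] [cite: HarishChandra1966, §9] [cite: Rogawski1990, §4.3 (4.3.1) p. 43; §14.2 (14.2.1) p. 232] -/
theorem integrable_orbitalIntegrand_of_archSchwartzOn_antidiagOne_three_of_isRegularElt'
    {g : ↥(UnitaryGroup.arch (↥(maximalRealSubfield L)) L (IsCMField.complexConj L) 3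
      (Matrix.of fun i j : Fin 3 => if i.val + j.val + 1 = 3 then (1 : L) else 0)) → ℂ}
    (hg : ArchSchwartzOn L 3 (Matrix.of fun i j : Fin 3 => if i.val + j.val + 1 = 3 then (1 : L) else 0) 1 g)
    (ν : Measure ↥(UnitaryGroup.arch (↥(maximalRealSubfield L)) L (IsCMField.complexConj L) 3
      (Matrix.of fun i j : Fin 3 => if i.val + j.val + 1 = 3 then (1 : L) else 0))) [ν.IsHaarMeasure] [ν.IsMulRightInvariant]
    [∀ a : ↥(UnitaryGroup.arch (↥(maximalRealSubfield L)) L (IsCMField.complexConj L) 3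
      (Matrix.of fun i j : Fin 3 => if i.val + j.val + 1 = 3 then (1 : L) else 0)),
      MeasurableSpace (↥(UnitaryGroup.arch (↥(maximalRealSubfield L)) L (IsCMField.complexConj L) 3
      (Matrix.of fun i j : Fin 3 => if i.val + j.val + 1 = 3 then (1 : L) else 0)) ⧸ Subgroup.centralizer ({a} : Set _))]
    [∀ a : ↥(UnitaryGroup.arch (↥(maximalRealSubfield L)) L (IsCMField.complexConj L) 3
      (Matrix.of fun i j : Fin 3 => if i.val + j.val + 1 = 3 then (1 : L) else 0)),
      BorelSpace (↥(UnitaryGroup.arch (↥(maximalRealSubfield L)) L (IsCMField.complexConj L) 3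
      (Matrix.of fun i j : Fin 3 => if i.val + j.val + 1 = 3 then (1 : L) else 0)) ⧸ Subgroup.centralizer ({a} : Set _))]
    (t : ∀ γ : ↥(UnitaryGroup.arch (↥(maximalRealSubfield L)) L (IsCMField.complexConj L) 3
      (Matrix.of fun i j : Fin 3 => if i.val + j.val + 1 = 3 then (1 : L) else 0)), Measure ↥(Subgroup.centralizer ({γ} : Set _)))
    (m : OrbitalMeasureFamily ↥(UnitaryGroup.arch (↥(maximalRealSubfield L)) L (IsCMField.complexConj L) 3
      (Matrix.of fun i j : Fin 3 => if i.val + j.val + 1 = 3 then (1 : L) else 0)))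
    (hW : m.IsQuotientOf (fun γ => IsRegularElt (γ.val : GL (Fin 3) (mixedSpace L))) ν t)
    (c : ConjClasses ↥(UnitaryGroup.arch (↥(maximalRealSubfield L)) L (IsCMField.complexConj L) 3
      (Matrix.of fun i j : Fin 3 => if i.val + j.val + 1 = 3 then (1 : L) else 0)))
    (hc : IsRegularElt ((Quotient.out c).val : GL (Fin 3) (mixedSpace L))) :
    Integrable (descConj (Quotient.out c) (Subgroup.centralizer ({Quotient.out c} : Set _))
      (fun _ h => Subgroup.mem_centralizer_singleton_iff.1 h) g) (m c) :=
  integrable_orbitalIntegrand_of_archSchwartzOn_antidiagOne_three_of_isRegularElt L hg ν t m hW c hc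
    (fun _ _ _ hγ hu hα1 ν _ _ _ ρ _ _ _ _ => quotientMeasure_hsOrbitBall_le_linear_of_diag_hyperbolic hγ hu hα1 ν ρ)

end Final

end Literature.NumberTheory.Rogawski1990

end
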